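import Summits.Ventures.HodgeRepro2.T5SU11SphericalTransformDecay
import Summits.Ventures.HodgeRepro2.T5SU11KernelCompositionDerivative

/-!
# The spherical transform of the kernel's rows: `∫ K_λ(t, s) φ_{λ′}(a_s) sinh 2s ds = φ_{λ′}(a_t)/(μ′ − μ)`, and the powers on the spherical functions

The spherical functions are eigenfunctions of the resolvent (row 4xx: `G^I_λ φ_{λ′} = φ_{λ′}/(μ′ − μ)` for `1 < λ′ < λ` and for
`2 − λ < λ′ < 1`), hence of its powers; read through the kernel representations of the resolvent (row 524) and of its powers
(row 585, class sources of rate `> 1`):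

* `iterate_sph_eq`, `iterate_sph_eq'` — **`(G^I_λ)ⁿ φ_{λ′} = φ_{λ′}/(μ′ − μ)ⁿ`** on `(0, ∞)`;
* `integral_kernel_mul_sph_eq` — **`∫ K_λ(t, s) φ_{λ′}(a_s) sinh 2s ds = φ_{λ′}(a_t)/(μ′ − μ)`** for `1 < λ′ < λ`: the spherical
  transform of the kernel's row is the spherical function times the resolvent kernel in the spectral variable;
* `sph_class_data'`, `integral_kernel_mul_sph_eq'` — the same in the reflected range `2 − λ < λ′ < 1` (`φ_{λ′} = φ_{2−λ′}` is a class
  source of rate `λ′ > 2 − λ`);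
* `integral_sphDecay_mul_sph_eq'` — the transform of the decaying solution in the reflected range `2 − λ < λ′ < 1`
  (row 628 by the symmetry `φ_{λ′} = φ_{2−λ′}`).

(The analogous transform of the COMPOSED kernels' rows is not derived here: the spherical functions are never class sources
of rate `> 1`, which row 585's kernel representation of the powers requires.)

Nothing is claimed about (N).

Blind lane: Mathlib + the HodgeRepro2 prefix only; no sorry; axioms ⊆ {propext, Classical.choice,
Quot.sound}.
-/

namespace Summit.Ventures.HodgeRepro2.T5SU11SphericalTransformKernel

open Filter Topology MeasureTheory
open Set (Ioi Ioc)
open T5SU11Cartan T5SU11SphericalFunction T5SU11SphericalBounds T5SU11SphericalContinuous T5SU11SphericalSymmetry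
  T5SU11SphericalDecay T5SU11RadialGreenKernel T5SU11RadialGreenImproper T5SU11RadialGreenImproperDecaySource
  T5SU11ResolventKernelComposition T5SU11ResolventEigenfunction T5SU11KernelCompositionDerivative
  T5SU11WeightedSpaceGroundStateOrder T5SU11SphericalTransformDecay

section measure

variable [MeasurableSpace Circle] [BorelSpace Circle]

variable {lam : ℝ} (hlam : 1 < lam)

include hlam in
/-- **`(G^I_λ)ⁿ φ_{λ′}(t) = φ_{λ′}(a_t)/(μ′ − μ)ⁿ`** for `1 < λ′ < λ` and `t > 0`. -/
theorem iterate_sph_eq {lam' : ℝ} (h1 : 1 < lam') (h2 : lam' < lam) (n : ℕ) :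
    ∀ t, 0 < t → ((greenSolI (fun t => sph lam (hyp t)) (sphDecay lam))^[n] (fun s => sph lam' (hyp s))) t
      = (1 / (lam' * (lam' - 2) - lam * (lam - 2))) ^ n * sph lam' (hyp t) := by
  induction n with
  | zero =>
    intro t _
    simp
  | succ n ih =>
    intro t ht
    rw [Function.iterate_succ_apply', greenSolI_congr_Ioi (fun t => sph lam (hyp t)) (sphDecay lam)
      (g := fun r => (1 / (lam' * (lam' - 2) - lam * (lam - 2))) ^ n * sph lam' (hyp r)) (fun r hr => ih r hr) ht,
      greenSolI_const_mul_source, greenSolI_sph_eq hlam h1 h2 ht, pow_succ]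
    ring

include hlam in
/-- **`(G^I_λ)ⁿ φ_{λ′}(t) = φ_{λ′}(a_t)/(μ′ − μ)ⁿ`** for `2 − λ < λ′ < 1` and `t > 0`. -/
theorem iterate_sph_eq' {lam' : ℝ} (h1 : 2 - lam < lam') (h2 : lam' < 1) (n : ℕ) :
    ∀ t, 0 < t → ((greenSolI (fun t => sph lam (hyp t)) (sphDecay lam))^[n] (fun s => sph lam' (hyp s))) t
      = (1 / (lam' * (lam' - 2) - lam * (lam - 2))) ^ n * sph lam' (hyp t) := by
  induction n with
  | zero =>
    intro t _
    simp
  | succ n ih =>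
    intro t ht
    rw [Function.iterate_succ_apply', greenSolI_congr_Ioi (fun t => sph lam (hyp t)) (sphDecay lam)
      (g := fun r => (1 / (lam' * (lam' - 2) - lam * (lam - 2))) ^ n * sph lam' (hyp r)) (fun r hr => ih r hr) ht,
      greenSolI_const_mul_source, greenSolI_sph_eq' hlam h1 h2 ht, pow_succ]
    ring

include hlam in
/-- **The spherical transform of the kernel's row**: `∫ K_λ(t, s) φ_{λ′}(a_s) sinh 2s ds = φ_{λ′}(a_t)/(μ′ − μ)` for `1 < λ′ < λ`. -/
theorem integral_kernel_mul_sph_eq {lam' : ℝ} (h1 : 1 < lam') (h2 : lam' < lam) {t : ℝ} (ht : 0 < t) :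
    ∫ s in Ioi 0, sphGreenKernel lam t s * sph lam' (hyp s) * Real.sinh (2 * s)
      = sph lam' (hyp t) / (lam' * (lam' - 2) - lam * (lam - 2)) := by
  obtain ⟨Φ, hΦ0, hΦ⟩ := exists_abs_sph_le_one lam'
  obtain ⟨C, s₀, hC⟩ := exists_abs_sph_le_exp h1
  have hg : ContinuousOn (fun s => sph lam' (hyp s)) (Ioi 0) := (continuous_sph_hyp lam').continuousOn
  have hε : 2 - lam < 2 - lam' := by linarith
  have hB := integrableOn_sph_mul_mul_sinh_Ioc hg hΦ hΦ0 lam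
  have hA := integrableOn_sphDecay_mul_mul_sinh hlam hg hΦ hΦ0 hε hC
  rw [← greenSolI_sph_eq hlam h1 h2 ht, greenSolI_eq_integral_kernel hB hA ht]
  apply setIntegral_congr_fun measurableSet_Ioi
  intro s _
  simp only [sphGreenKernel]

/-- The class data of `φ_{λ′}` for `λ′ < 1`: bounded on `(0, 1]` and decaying at the rate `λ′` (`φ_{λ′} = φ_{2−λ′}`, row 428). -/
theorem sph_class_data' {lam' : ℝ} (h2 : lam' < 1) :
    ∃ Φ : ℝ, 0 ≤ Φ ∧ (∀ s ∈ Ioc (0 : ℝ) 1, |sph lam' (hyp s)| ≤ Φ) ∧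
      ∃ C s₀ : ℝ, ∀ s, s₀ ≤ s → |sph lam' (hyp s)| ≤ C * Real.exp (-lam' * s) := by
  obtain ⟨Φ, hΦ0, hΦ⟩ := exists_abs_sph_le_one lam'
  obtain ⟨C, s₀, hC'⟩ := exists_abs_sph_le_exp (lam' := 2 - lam') (by linarith)
  refine ⟨Φ, hΦ0, hΦ, C, s₀, fun s hs => ?_⟩
  have := hC' s hs
  rw [← sph_two_sub_hyp] at this
  simpa only [show -(2 - (2 - lam')) = -lam' by ring] using this

include hlam in
/-- **The spherical transform of the kernel's row in the reflected range**:
`∫ K_λ(t, s) φ_{λ′}(a_s) sinh 2s ds = φ_{λ′}(a_t)/(μ′ − μ)` for `2 − λ < λ′ < 1`. -/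
theorem integral_kernel_mul_sph_eq' {lam' : ℝ} (h1 : 2 - lam < lam') (h2 : lam' < 1) {t : ℝ} (ht : 0 < t) :
    ∫ s in Ioi 0, sphGreenKernel lam t s * sph lam' (hyp s) * Real.sinh (2 * s)
      = sph lam' (hyp t) / (lam' * (lam' - 2) - lam * (lam - 2)) := by
  obtain ⟨Φ, hΦ0, hΦ, C, s₀, hC⟩ := sph_class_data' h2
  have hg : ContinuousOn (fun s => sph lam' (hyp s)) (Ioi 0) := (continuous_sph_hyp lam').continuousOn
  have hB := integrableOn_sph_mul_mul_sinh_Ioc hg hΦ hΦ0 lam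
  have hA := integrableOn_sphDecay_mul_mul_sinh hlam hg hΦ hΦ0 h1 hC
  rw [← greenSolI_sph_eq' hlam h1 h2 ht, greenSolI_eq_integral_kernel hB hA ht]
  apply setIntegral_congr_fun measurableSet_Ioi
  intro s _
  simp only [sphGreenKernel]

include hlam in
/-- **The spherical transform of the decaying solution in the reflected range**: `∫_0^∞ χ_λ(s) φ_{λ′}(a_s) sinh 2s ds = 1/(μ − μ′)`
for `2 − λ < λ′ < 1` (row 628 for `1 < λ′ < λ`). -/
theorem integral_sphDecay_mul_sph_eq' {lam' : ℝ} (h1 : 2 - lam < lam') (h2 : lam' < 1) :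
    ∫ s in Ioi 0, sphDecay lam s * sph lam' (hyp s) * Real.sinh (2 * s)
      = 1 / (lam * (lam - 2) - lam' * (lam' - 2)) := by
  have h := integral_sphDecay_mul_sph_eq hlam (lam' := 2 - lam') (by linarith) (by linarith)
  have e : (fun s => sphDecay lam s * sph (2 - lam') (hyp s) * Real.sinh (2 * s))
      = fun s => sphDecay lam s * sph lam' (hyp s) * Real.sinh (2 * s) := by
    funext s
    rw [← sph_two_sub_hyp]
  rw [e] at h
  rw [h]
  congr 1
  ring

end measure

end Summit.Ventures.HodgeRepro2.T5SU11SphericalTransformKernel
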